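import Literature.MathematicalPhysics.QuantumFieldTheory.Balaban1983to89.B2Eq276HiggsRegion

/-!
# `Balaban1983to89.B2Eq276DerivHiggsRegion` — [Balaban1982Higgs2] Lemma 2.4, proof step **(2.76) «for the derivative»** AT THE ZERO
# FIELD, p. 573, ON THE (Higgs)₂,₃ CARRIER OF RECORD: the MAIN TERM `a_k∂^ηG_k(□, 0)Q_k^*□₁φ′` of the derivative assembly (2.77)
# («(D^η_{A^{(k)}}φ^{(k)})(b) = U(A₀(Γ_{b₋,y}))(a_k∂^ηG_k(□, 0)Q_k^*□₁φ′)(b) + O((Lᵏε)^{κ₀}), b ⊂ □») is `(Lᵏε)⁻¹·O(λ + e^{−ρ/(4K₀)}|φ′(ȳ)|)` —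
# print's «so the same conclusion holds» for the derivative, i.e. the (2.64)/(2.60) half of «the same reasoning … as to A^{(k)} in the
# proof of Lemma 2.3», the derivative twin of p23's F3′ `B2Eq276HiggsRegion.eq276_zero_region`

statement-level skeleton of published theorems with citation tags; proofs where landed; nothing here is a claim
about the Yang–Mills mass gap

PDF held: `paper:balaban1982-cmp86-higgs23-ii` (journal page = PDF page + 554), p. 572 [PDF 18] (Lemma 2.4 (2.65)–(2.66)) and p. 573
[PDF 19] ((2.75)–(2.77)) re-read this session on the ×2 renders `run/shared/lean/pub/pub-balaban/b2b-balaban-ref1/pages/1982-cmp86-higgs23-II/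
1982-cmp86-higgs23-II-p018-x2.png` / `…-p019-x2.png`; p. 571 [PDF 17] (Lemma 2.3 proof (2.62)–(2.64), render `…-p017-x2.png`); pp. 570–571
(Prop. 2.2 (2.58)).

CITATION HEADER (lean-in-tree rule).  T. Bałaban, *(Higgs)₂,₃ quantum fields in a finite volume. II. An upper bound*,
Commun. Math. Phys. **86** (1982) 555–594, doi:10.1007/bf01214890 [Balaban1982Higgs2]; operators of T. Bałaban, *(Higgs)₂,₃
quantum fields in a finite volume. I. A lower bound*, Commun. Math. Phys. **85** (1982) 603–626 [Balaban1982Higgs1] AS TYPED by the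
typer (`HiggsLattice`, `HiggsAveraging`, `HiggsCovariance`, `B2Eq255Concrete`).  Cell `lit-balaban` (HOME `run/shared/lean/pub/lit-balaban/`),
reader/typer seat **r14** gen 21 (B2 second reader; unit `lit-balaban-r14-g21`; free-target protocol G.5-34(d), TAKING line HOME/STATUS.md
2026-08-23T07:13Z); SKELETON row **B2.Lem2.4** (Lemma 2.4 (2.65)–(2.66) p. 572; fold owner r02, second reader r14; decl of record
`B2.Lemma24Printed`, head `proved p250408 · …` UNCHANGED — cells-only member; the owner's B2-CLOSURE §3.3 lists «the derivative clause
(2.66)/(2.77)» among the located residue of Lemma 2.4 on the carrier of record, «cell items for any seat»); brick D3′ = the derivative twin of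
p23's F3′ `B2Eq276HiggsRegion` (p350431).  Cross-references: rows **B2.Prop2.2** ((2.58), derivative member for regions — p17's
`B2Ineq258HiggsRegion.ineq258_DGQ_higgs_region_coarse`, the input of §3), **B2.Lem2.3** ((2.64) ⇒ (2.60): the constant term has zero
derivative — r14's `B2Lemma23HiggsLattice.norm_cutMin_shift_sub_le` is the same mechanism for `A^{(k)}` on the whole torus), **B2.Eq2.55**
((2.56)), **B1.Eq1.7**, **B1.Eq1.4**.  USED BY NAME, never restated: p23's `B2Eq276HiggsRegion.eq275_region` ((2.75) for the typer's (2.56)),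
the typer's `B2Eq255Concrete.{bgScalar256, bgScalar256_eq, cutTo, cutTo_of_mem, underRegion, mem_underRegion}`, p23's
`B2Eq267HiggsRegion.{cutTo_eq_sum, covDeriv_smul', covDeriv_bgScalar256_eq_sum}` ((2.67) §5 «the same equality for the covariant
derivative»), p17's `B2Ineq258HiggsRegion.{ineq258_DGQ_higgs_region_coarse, chi_smul_avgQkAdj_single}`, p35's
`B1Ineq225DerivRegularRegion.{covDeriv_add', covDeriv_sum'}` and `B1Ineq226RegularRegion.covDeriv_sub'`, r14's
`B1Ineq234Concrete.tdist_self` / `B1Ineq234LevelZero.tdist_shift_le_one`, the typer's `B2Eq230CondShiftBound.sum_exp_neg_tdist_le` with `B4Sect5Proof.latticeConst`,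
`HiggsLattice.{covDeriv, covDeriv_zero, sderiv}`.

WHAT IS PRINTED (p. 573 [PDF 19], after (2.74)).  *«Now we can apply the same reasoning to the configuration a_kG_k(□, 0)Q_k^*□₁φ′ as to
A^{(k)} in the proof of Lemma 2.3, especially we have a_kG_k(□, 0)Q_k^*1 = … = 1 − m²(Lᵏε)²G_k(□, 0)Q_k^*1, (2.75) so the same conclusion
holds and we get (a_kG_k(□, 0)Q_k^*□₁φ′)(x) = φ′(y) + O(p(Lᵏε)), x ∈ Bᵏ(y). (2.76) … we finally get (2.65). It was mentioned several
times that the corresponding equalities hold for the covariant derivatives of φ^{(k)} and we have (D^η_{A^{(k)}}φ^{(k)})(b) =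
U(A₀(Γ_{b₋,y}))(a_k∂^ηG_k(□, 0)Q_k^*□₁φ′)(b) + O((Lᵏε)^{κ₀}), b ⊂ □. (2.77)»*; p. 572: *«(D^η_{A^{(k)}}φ^{(k)})(b) = O(p(Lᵏε)) for
b ⊂ Bᵏ(Λ₇^{(k−1)′}). (2.66)»*; p. 571 (proof of Lemma 2.3): *«Furthermore, because G_kQ_k^*1 is a constant, from (2.61) we have
(∂^η_μA^{(k)})(x) = a_k(∂^η_μζ^{(k)}G_kQ_k^*(A − A(y)))(x) − a_k(∂^η_μ(1 − ζ^{(k)})G_kQ_k^*1)(x)A(y), x ∈ Bᵏ(y), y ∈ Λ₂^{(k−1)′}, (2.64) and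
the restrictions (2.55), Proposition 2.2 and the properties of the function ζ^{(k)} imply (2.60).»*; pp. 570–571 (2.58): *«|(D^η_AG_k(Ω,
A)Q_k^*(A))(b, y)| ≦ c₀exp(−δ₀dist(b, y)) for b ⊂ Ω, dist(b, Ωᶜ) ≧ R₀, y ∈ Ω^{(k)}»*.

THE ARGUMENT (print's «same reasoning», derivative half, on the carrier; ε-lattice currency `ℓ = Lᵏε = P.mesh k`, `m² ↦ msq`, the
covariant derivative (I.1.7) `D^ε_0 = ∂^ε` on the fine lattice `T_ε`, so print's `∂^η(·) = O(p)` on the `η = L^{−k}`-lattice reads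
`‖(D^ε_0 ·)(b)‖ ≤ ℓ⁻¹·O(p)` here).  Fix a bond `b = ⟨x, x + εe_μ⟩` deep inside `Ω = Bᵏ(□₂)` and put `ȳ = x_k`.  By linearity of `G_k(□,0)`,
`Q_k^*(0)` and of `D^ε_0` in the field, and by (2.75) (`a_kG_k(□,0)Q_k^*(1_{□₂}v) = (a_k/(a_k + m²ℓ²))·1_Ωv`, p23's `eq275_region`),
`D^ε_0(a_kG_kQ_k^*□₁φ′)(b) = D^ε_0(a_kG_kQ_k^*□₁φ′)(b) − D^ε_0((a_k/(a_k+m²ℓ²))1_Ωφ′(ȳ))(b)` — the subtracted term VANISHES because both ends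
of `b` lie in `Ω` («because G_kQ_k^*1 is a constant») — `= a_kℓ⁻²[Σ_{y′∈□₁}D^ε_0(G_kQ_k^*δ_{y′}(φ′(y′) − φ′(ȳ)))(b) − Σ_{y′∈□₂∖□₁}
D^ε_0(G_kQ_k^*δ_{y′}φ′(ȳ))(b)]`; each one-block term is bounded by the DERIVATIVE member of Prop. 2.2 (2.58) AT `A = 0` (p17, regions,
coarse exponent): `c₀e^{1/(2K₀)}·ℓ·e^{−|ȳ−y′|/(2K₀)}` times `|φ′(y′) − φ′(ȳ)| ≤ λ|ȳ − y′|` on `□₁` resp. times `|φ′(ȳ)|` with `|ȳ − y′| ≥ ρ`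
on `□₂ ∖ □₁`; `τe^{−τ/(2K₀)} ≤ 4K₀e^{−τ/(4K₀)}`, `e^{−τ/(2K₀)} ≤ e^{−ρ/(4K₀)}e^{−τ/(4K₀)}` (`τ ≥ ρ`) and the lattice sum `Σ_{y′}e^{−|ȳ−y′|/(4K₀)}
≤ K_d(1/(4K₀))` give `a_kℓ⁻²·c₀e^{1/(2K₀)}ℓ·K_d·(4K₀λ + e^{−ρ/(4K₀)}|φ′(ȳ)|) = a_k·C₁·ℓ⁻¹(4K₀λ + e^{−ρ/(4K₀)}|φ′(ȳ)|)` with F3′'s constant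
`C₁ = c₀e^{1/(2K₀)}K_d(1/(4K₀))` (p17's derivative constant `c₀`).

v1.1 (same seat, 2026-08-23, DEDUP HYGIENE, zero weight): v1.0 (p356955 ✓ daa73e69fc26) re-proved `covDeriv_bgScalar256_eq_sum` and a
private `covDeriv_smul'`, both of which p23's `B2Eq267HiggsRegion` §5 already provides in this file's import closure (:456, :440) — v1.1
DROPS the duplicate (nothing referenced it) and uses p23's two lemmas BY NAME; the other declarations and every statement are byte-identical.

WHAT THIS FILE PROVES (kernel-checked, zero `sorry`; theorems only — NO definition, NO `Prop`-valued fact; axioms standard).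
 §1 `sderiv_cutTo_const_eq_zero` / **`covDeriv_cutTo_const_eq_zero`** (the cut constant `1_Ωv`
    has zero (covariant, `A = 0`) derivative on the bonds with both ends in `Ω`), **`covDeriv_bgScalar256_const_eq_zero`** (hence so has
    the (2.75) field `a_kG_k(□,0)Q_k^*(1_{□₂}v)` — print p. 571 «because G_kQ_k^*1 is a constant»); the derivative of (2.56) at a
    bond as `a_kℓ⁻²Σ_{y′∈Λ₆}` of one-block derivative terms is p23's `B2Eq267HiggsRegion.covDeriv_bgScalar256_eq_sum` (by name).
 §2 bookkeeping (private): two sums against one weight, the tail exponent, `τe^{−τ/(2K₀)} ≤ 4K₀e^{−τ/(4K₀)}` — copies of F3′'s private lemmas.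
 §3 **`eq276_deriv_zero_region`** — F3′'s `eq276_zero_region` WORD FOR WORD except the located edits: a direction binder `(μ : Fin P.d)`
    after `x`; the depth of `x` raised by one fine step (`… * (P.d + 1) + 1`, p17's derivative-member depth); the left side
    `‖bgScalar256 … 0 φ x − (a_k/(a_k + m²ℓ²))•φ(x_k)‖` REPLACED by `‖covDeriv C 0 (bgScalar256 … 0 φ) ⟨x, μ⟩‖` (no constant: §1); the
    right side gains the factor `(P.mesh k)⁻¹`.  Same constants shape `∃ K₀min ∀ K₀ ≥ K₀min ∃ C₁ ≥ 0 ∀ P …`.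

HONEST SCOPE / DIFFERENCES FROM PRINT (recorded, not hidden; one sentence each).  (a) ZERO FIELD ONLY, exactly print's case after the gauge
step (2.73)/(2.74): this is the main term `a_k∂^ηG_k(□,0)Q_k^*□₁φ′` of (2.77); the prefactor `U(A₀(Γ_{b₋,y}))` (norm one), the gauge
identity «(2.74) for the derivative» ((2.69)–(2.70)), the expansion «(2.68) … and similarly for the derivative» and the localisation
«(2.67) … and the same equality for the covariant derivative of φ^{(k)}» are NOT here (later bricks D2′/D4′/D1′ and the assembly D5 of
(2.77)/(2.66), each its own file).  (b) THE BLOCK OF THE BOND: `ȳ = x_k` is the block of the source `b₋ = x` of `b = ⟨x, x + εe_μ⟩` (print's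
«b ⊂ □», (2.77)'s `Γ_{b₋,y}`); `b₊` may lie in the next block — immaterial, only `b₋, b₊ ∈ Ω` is used (depth hypothesis).  (c) EXPLICIT RIGHT
SIDE instead of print's `O(p(Lᵏε))`: `a_k·C₁·(Lᵏε)⁻¹·(4K₀λ + e^{−ρ/(4K₀)}|φ′(ȳ)|)` with the Lipschitz modulus `λ` of `φ′` about `ȳ` on `□₁`
(print: «|φ′(y″) − φ′(y′)| ≦ O(1)p(Lᵏε)» per coarse step, so `λ ⇐ O(1)p(Lᵏε)` — F6/F9 feed it by name from (2.55)₃) and the separation `ρ` of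
`□₂ ∖ □₁` from `ȳ` (print: the radii `2r(Lᵏε)`, `4r(Lᵏε)` of `□₁`, `□₂`) as free letters — the readings are the user's, as in F3′; with them
the bound is `(Lᵏε)⁻¹·O(p(Lᵏε))`, the ε-lattice form of (2.66)'s `O(p(Lᵏε))` for `∂^η`, `η = L^{−k}`.  (d) REGION/DEPTH: `□ = Bᵏ(□₂)` any
big-block union (cube size `K₀`, `K₀ ∣ M`) and `x` at depth `2r_S + 2LᵏK₀(d+1) + 1` — p17's `R₀`-clause of (2.58) for the derivative
member («dist(b, Ωᶜ) ≧ R₀»); print's `□₂` = the large blocks within `4r(Lᵏε)` of `y`.  (e) CONSTANTS: `c₀` is p17's (existential, from p35's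
region derivative bounds), `C₁ = c₀e^{1/(2K₀)}K_d(1/(4K₀))` explicit in it; NOTHING is minted.  (f) No `m²ℓ²/(a_k + m²ℓ²)` correction
appears (it multiplies a constant field, whose derivative vanishes) — as in Lemma 2.3's (2.60) versus (2.59).  NOT summit progress.
-/

open scoped BigOperators

noncomputable section

namespace Literature.MathematicalPhysics.QuantumFieldTheory.Balaban1983to89.B2Eq276DerivHiggsRegion

open Literature.MathematicalPhysics.QuantumFieldTheory.Balaban1983to89.HiggsLattice
open Literature.MathematicalPhysics.QuantumFieldTheory.Balaban1983to89.HiggsAveraging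
open Literature.MathematicalPhysics.QuantumFieldTheory.Balaban1983to89.HiggsCovariance
open Literature.MathematicalPhysics.QuantumFieldTheory.Balaban1983to89.HiggsCovariancePos
open Literature.MathematicalPhysics.QuantumFieldTheory.Balaban1983to89.B2Eq255Concrete (bgScalar256 bgScalar256_eq cutTo
  cutTo_of_mem underRegion mem_underRegion)
open Literature.MathematicalPhysics.QuantumFieldTheory.Balaban1983to89.B2Eq267HiggsRegion (cutTo_eq_sum covDeriv_smul'
  covDeriv_bgScalar256_eq_sum)
open Literature.MathematicalPhysics.QuantumFieldTheory.Balaban1983to89.B2Eq276HiggsRegion (eq275_region)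
open Literature.MathematicalPhysics.QuantumFieldTheory.Balaban1983to89.B2Ineq258HiggsRegion (ineq258_DGQ_higgs_region_coarse
  chi_smul_avgQkAdj_single)
open Literature.MathematicalPhysics.QuantumFieldTheory.Balaban1983to89.B1Ineq225DerivRegularRegion (covDeriv_add' covDeriv_sum')
open Literature.MathematicalPhysics.QuantumFieldTheory.Balaban1983to89.B1Ineq226RegularRegion (covDeriv_sub')
open Literature.MathematicalPhysics.QuantumFieldTheory.Balaban1983to89.B1Ineq234Concrete (tdist_self)
open Literature.MathematicalPhysics.QuantumFieldTheory.Balaban1983to89.B1Ineq234LevelZero (tdist_shift_le_one)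
open Literature.MathematicalPhysics.QuantumFieldTheory.Balaban1983to89.B1TorusRegionHSizes (IsBigBlockUnion)
open Literature.MathematicalPhysics.QuantumFieldTheory.Balaban1983to89.B1TorusCubeCover (half)
open Literature.MathematicalPhysics.QuantumFieldTheory.Balaban1983to89.B1TorusCubeLocality26 (rS)
open Literature.MathematicalPhysics.QuantumFieldTheory.Balaban1983to89.B1TorusRegionRop (chi)
open Literature.MathematicalPhysics.QuantumFieldTheory.Balaban1983to89.B2Eq230CondShiftBound (sum_exp_neg_tdist_le)
open Literature.MathematicalPhysics.QuantumFieldTheory.Balaban1983to89.B4Sect5Proof (latticeConst latticeConst_nonneg)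

variable {P : HiggsLattice.Params} {N : ℕ}

/-! ## §1 The constant term has zero derivative; the derivative of (2.56) as a sum over source blocks -/

section Const

variable (C : ChargeData N) {k : ℕ}

/-- **The cut constant `1_Ωv` has zero difference derivative (I.1.4) on every bond with both ends in `Ω`.**
[cite: Balaban1982Higgs1, (1.4) p.604] [cite: Balaban1982Higgs2, Lemma 2.3 proof (2.64) p.571 «because G_kQ_k^*1 is a constant»] -/
theorem sderiv_cutTo_const_eq_zero (Ω : Finset (HiggsLattice.Site P 0)) (v : EuclideanSpace ℝ (Fin N))
    {x : HiggsLattice.Site P 0} {μ : Fin P.d} (hx : x ∈ Ω) (hxμ : x.shift μ ∈ Ω) :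
    sderiv (cutTo Ω (fun _ => v)) (⟨x, μ⟩ : HiggsLattice.PBond P 0) = 0 := by
  unfold sderiv
  have ht : (⟨x, μ⟩ : HiggsLattice.PBond P 0).tgt = x.shift μ := rfl
  rw [ht, cutTo_of_mem Ω _ hxμ, cutTo_of_mem Ω _ (show (⟨x, μ⟩ : HiggsLattice.PBond P 0).src ∈ Ω from hx), sub_self,
    smul_zero]

/-- **The cut constant `1_Ωv` has zero covariant derivative at `A = 0` on the bonds with both ends in `Ω`** (`U(0) = 1`).
[cite: Balaban1982Higgs1, (1.7) p.605] [cite: Balaban1982Higgs2, Lemma 2.3 proof (2.64) p.571 «because G_kQ_k^*1 is a constant»] -/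
theorem covDeriv_cutTo_const_eq_zero (Ω : Finset (HiggsLattice.Site P 0)) (v : EuclideanSpace ℝ (Fin N))
    {x : HiggsLattice.Site P 0} {μ : Fin P.d} (hx : x ∈ Ω) (hxμ : x.shift μ ∈ Ω) :
    covDeriv C (0 : HiggsLattice.VecField P 0) (cutTo Ω (fun _ => v)) (⟨x, μ⟩ : HiggsLattice.PBond P 0) = 0 := by
  rw [covDeriv_zero, sderiv_cutTo_const_eq_zero Ω v hx hxμ]

/-- **(2.75) ⇒ THE CONSTANT TERM HAS ZERO DERIVATIVE**: on `Ω = Bᵏ(□₂)` the (2.56) field of the constant unit-lattice field `v` on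
`□₁ = □₂` at zero vector field, `a_kG_k(□,0)Q_k^*(1_{□₂}v) = (a_k/(a_k + m²ℓ²))·1_Ωv` (p23's `eq275_region`), has `D^ε_0(·)(b) = 0` on every
bond `b = ⟨x, x + εe_μ⟩` with `x, x + εe_μ ∈ Ω` (`m² > 0`, `a_k ≥ 0`, `k ≤ K`) — print p. 571: «because G_kQ_k^*1 is a constant».
[cite: Balaban1982Higgs2, Lemma 2.4 proof (2.75) p.573] [cite: Balaban1982Higgs2, Lemma 2.3 proof (2.64) p.571] -/
theorem covDeriv_bgScalar256_const_eq_zero (hk : k ≤ P.K) {msq : ℝ} (hmsq : 0 < msq) {a : ℝ} (hak : 0 ≤ B1.aSeq a P.L k)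
    (sq : Finset (HiggsLattice.Site P k)) (v : EuclideanSpace ℝ (Fin N)) {x : HiggsLattice.Site P 0} {μ : Fin P.d}
    (hx : x ∈ underRegion k sq) (hxμ : x.shift μ ∈ underRegion k sq) :
    covDeriv C (0 : HiggsLattice.VecField P 0) (bgScalar256 C msq a k sq sq (0 : HiggsLattice.VecField P 0) (fun _ => v))
        (⟨x, μ⟩ : HiggsLattice.PBond P 0) = 0 := by
  rw [eq275_region C hk hmsq hak sq v, covDeriv_smul', covDeriv_cutTo_const_eq_zero C (underRegion k sq) v hx hxμ, smul_zero]

end Const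

/-! ## §2 Bookkeeping: two sums against one summable weight; the two exponent inequalities -/

section Bookkeeping

/-- two sums against one summable weight: `‖u′ − u‖ ≤ αe` on `S`, `‖u‖ ≤ βe` on `T ∖ S`, `e ≥ 0`, `Σ_T e ≤ K` give
`‖Σ_T u − Σ_S u′‖ ≤ (α + β)K`. [folklore] -/
private theorem norm_sum_sub_sum_le'' {ι E : Type*} [SeminormedAddCommGroup E] [DecidableEq ι] (S T : Finset ι)
    (hST : S ⊆ T) (u u' : ι → E) (e : ι → ℝ) (he : ∀ y, 0 ≤ e y) {α β K : ℝ} (hα : 0 ≤ α) (hβ : 0 ≤ β)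
    (h1 : ∀ y ∈ S, ‖u' y - u y‖ ≤ α * e y) (h2 : ∀ y ∈ T \ S, ‖u y‖ ≤ β * e y) (hK : ∑ y ∈ T, e y ≤ K) :
    ‖∑ y ∈ T, u y - ∑ y ∈ S, u' y‖ ≤ (α + β) * K := by
  have hsplit : ∑ y ∈ T, u y - ∑ y ∈ S, u' y = ∑ y ∈ T \ S, u y + ∑ y ∈ S, (u y - u' y) := by
    rw [← Finset.sum_sdiff hST, Finset.sum_sub_distrib]
    abel
  have hS : ∑ y ∈ S, e y ≤ K :=
    (Finset.sum_le_sum_of_subset_of_nonneg hST fun y _ _ => he y).trans hK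
  have hTS : ∑ y ∈ T \ S, e y ≤ K :=
    (Finset.sum_le_sum_of_subset_of_nonneg Finset.sdiff_subset fun y _ _ => he y).trans hK
  rw [hsplit]
  calc ‖∑ y ∈ T \ S, u y + ∑ y ∈ S, (u y - u' y)‖
      ≤ ∑ y ∈ T \ S, ‖u y‖ + ∑ y ∈ S, ‖u y - u' y‖ :=
        (norm_add_le _ _).trans (add_le_add (norm_sum_le _ _) (norm_sum_le _ _))
    _ ≤ ∑ y ∈ T \ S, β * e y + ∑ y ∈ S, α * e y := by
        refine add_le_add (Finset.sum_le_sum fun y hy => h2 y hy) (Finset.sum_le_sum fun y hy => ?_)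
        rw [norm_sub_rev]
        exact h1 y hy
    _ = β * ∑ y ∈ T \ S, e y + α * ∑ y ∈ S, e y := by rw [Finset.mul_sum, Finset.mul_sum]
    _ ≤ β * K + α * K := add_le_add (mul_le_mul_of_nonneg_left hTS hβ) (mul_le_mul_of_nonneg_left hS hα)
    _ = (α + β) * K := by ring

/-- the tail exponent: `e^{−τ/(2K₀)} ≤ e^{−ρ/(4K₀)}·e^{−τ/(4K₀)}` for `τ ≥ ρ`. [folklore] -/
private theorem exp_tail_le'' (K₀ : ℕ) {ρ τ : ℝ} (h : ρ ≤ τ) :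
    Real.exp (-(1 / (2 * K₀) * τ)) ≤ Real.exp (-(1 / (4 * K₀) * ρ)) * Real.exp (-(1 / (4 * K₀) * τ)) := by
  rw [← Real.exp_add]
  refine Real.exp_le_exp.2 ?_
  have hδ : (0 : ℝ) ≤ 1 / (4 * K₀) := by positivity
  have h2 : (1 : ℝ) / (2 * K₀) = 2 * (1 / (4 * K₀)) := by ring
  rw [h2]
  nlinarith [mul_le_mul_of_nonneg_left h hδ]

/-- the Lipschitz exponent: `τe^{−τ/(2K₀)} ≤ 4K₀e^{−τ/(4K₀)}` for `τ ≥ 0`, `K₀ ≥ 1` (`se^{−s} ≤ 1`). [folklore] -/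
private theorem mul_exp_le'' {K₀ : ℕ} (hK₀ : 1 ≤ K₀) {τ : ℝ} (hτ : 0 ≤ τ) :
    τ * Real.exp (-(1 / (2 * K₀) * τ)) ≤ 4 * K₀ * Real.exp (-(1 / (4 * K₀) * τ)) := by
  have hK : (0 : ℝ) < K₀ := by exact_mod_cast hK₀
  have h4 : (0 : ℝ) < 4 * K₀ := by positivity
  set s : ℝ := 1 / (4 * K₀) * τ with hs
  have hs0 : 0 ≤ s := by positivity
  have hτs : τ = 4 * K₀ * s := by rw [hs]; field_simp
  have h2 : -(1 / (2 * (K₀ : ℝ)) * τ) = -s + -s := by rw [hs]; ring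
  rw [h2, Real.exp_add, hτs]
  have hse : s * Real.exp (-s) ≤ 1 := by
    rw [Real.exp_neg]
    have hexp : 0 < Real.exp s := Real.exp_pos s
    rw [mul_inv_le_iff₀ hexp, one_mul]
    linarith [Real.add_one_le_exp s]
  have hes : 0 ≤ Real.exp (-s) := Real.exp_nonneg _
  calc 4 * K₀ * s * (Real.exp (-s) * Real.exp (-s)) = 4 * K₀ * Real.exp (-s) * (s * Real.exp (-s)) := by ring
    _ ≤ 4 * K₀ * Real.exp (-s) * 1 := mul_le_mul_of_nonneg_left hse (by positivity)
    _ = 4 * K₀ * Real.exp (-s) := mul_one _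

end Bookkeeping

/-! ## §3 (2.76) FOR THE DERIVATIVE AT THE ZERO FIELD: `‖(a_k∂G_k(□,0)Q_k^*□₁φ′)(b)‖ ≤ a_kC₁ℓ⁻¹(4K₀λ + e^{−ρ/(4K₀)}|φ′(ȳ)|)` -/

section Eq276Deriv

/-- **(2.76) «FOR THE DERIVATIVE» AT THE ZERO FIELD, ON THE (Higgs)₂,₃ CARRIER** (ε-lattice currency) — the size of the main term of
(2.77).  For `d ≥ 1`, `L ≥ 2`, `a, m² > 0`, `N`, charge data and a mesh cap `ε₀`: there are `K₀min` and, for every cube size `K₀ ≥ K₀min`,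
a constant `C₁ ≥ 0` such that on every torus of the carrier with `K₀ ∣ M`, at every level `1 ≤ k ≤ K_P` with `3LᵏK₀ ≤ |T_ε|_μ` and
`Lᵏε ≤ ε₀`, for all `□₁ ⊆ □₂ ⊂ T^{(k)}` with `□ = Bᵏ(□₂)` a big-block union, every bond `b = ⟨x, x + εe_μ⟩` with
`{|z − x| ≤ 2r_S + 2LᵏK₀(d+1) + 1} ⊂ □` (`ȳ = x_k`), every unit-lattice field `φ′` with `|φ′(y′) − φ′(ȳ)| ≤ λ|ȳ − y′|` on `□₁` (`λ ≥ 0`,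
distance (1.3) of `T^{(k)}`) and every `ρ ≤ |ȳ − y′|` for all `y′ ∈ □₂ ∖ □₁`:
`‖(D^ε_0(a_kG_k(□, 0)Q_k^*□₁φ′))(b)‖ ≤ a_k·C₁·(Lᵏε)⁻¹·(4K₀λ + e^{−ρ/(4K₀)}|φ′(ȳ)|)`, the field being the typer's (2.56)
`bgScalar256 … □₂ □₁ 0 φ′` and `C₁ = c₀e^{1/(2K₀)}K_d(1/(4K₀))` with p17's derivative (2.58) constant `c₀`.  TYPED vs PRINTED: p23's F3′
`B2Eq276HiggsRegion.eq276_zero_region` word for word except: `+ (μ : Fin P.d)`; depth `… * (P.d + 1)` ↦ `… * (P.d + 1) + 1`; left side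
↦ the covariant derivative at `⟨x, μ⟩` of the same field (no constant subtracted); right side `× (P.mesh k)⁻¹`.
[cite: Balaban1982Higgs2, Lemma 2.4 proof (2.76)–(2.77) p.573 «so the same conclusion holds … (D^η_{A^{(k)}}φ^{(k)})(b) = U(A₀(Γ_{b₋,y}))(a_k∂^ηG_k(□, 0)Q_k^*□₁φ′)(b) + O((Lᵏε)^{κ₀}), b ⊂ □»]
[cite: Balaban1982Higgs2, Lemma 2.4 (2.66) p.572] [cite: Balaban1982Higgs2, Prop. 2.2 (2.58) pp.570–571]
[cite: Balaban1982Higgs2, Lemma 2.3 proof (2.64) p.571] -/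
theorem eq276_deriv_zero_region (d L : ℕ) (hd : 1 ≤ d) (hL : 2 ≤ L) {a : ℝ} (ha : 0 < a) {msq : ℝ} (hmsq : 0 < msq)
    (N : ℕ) (C : ChargeData N) (ε₀ : ℝ) :
    ∃ K₀min : ℕ, ∀ K₀ : ℕ, K₀min ≤ K₀ → ∃ C₁ : ℝ, 0 ≤ C₁ ∧
      ∀ (P : HiggsLattice.Params), P.d = d → P.L = L → K₀ ∣ P.M →
      ∀ {k : ℕ}, 1 ≤ k → k ≤ P.K → (∀ μ, 3 * half P k K₀ ≤ P.sitesPerDir 0 μ) → P.mesh k ≤ ε₀ →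
      ∀ (sq₂ sq₁ : Finset (HiggsLattice.Site P k)), sq₁ ⊆ sq₂ → IsBigBlockUnion k K₀ (underRegion k sq₂) →
      ∀ (x : HiggsLattice.Site P 0) (μ : Fin P.d),
        (∀ z, HiggsLattice.Site.tdist x z ≤ 2 * rS P k K₀ + 2 * half P k K₀ * (P.d + 1) + 1 → z ∈ underRegion k sq₂) →
      ∀ (φ : HiggsLattice.ScalarField P k N) (lam : ℝ), 0 ≤ lam →
        (∀ y ∈ sq₁, ‖φ y - φ (blockIter k x)‖ ≤ lam * (HiggsLattice.Site.tdist (blockIter k x) y : ℝ)) →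
      ∀ (ρ : ℝ), (∀ y ∈ sq₂, y ∉ sq₁ → ρ ≤ (HiggsLattice.Site.tdist (blockIter k x) y : ℝ)) →
        ‖covDeriv C (0 : HiggsLattice.VecField P 0) (bgScalar256 C msq a k sq₂ sq₁ (0 : HiggsLattice.VecField P 0) φ)
            (⟨x, μ⟩ : HiggsLattice.PBond P 0)‖
          ≤ B1.aSeq a P.L k * C₁ * (P.mesh k)⁻¹ *
              (4 * K₀ * lam + Real.exp (-(1 / (4 * K₀) * ρ)) * ‖φ (blockIter k x)‖) := by
  obtain ⟨c₀, hc₀, K₁, hD⟩ := ineq258_DGQ_higgs_region_coarse d L hd hL ha hmsq N C ε₀ 0 1 le_rfl one_pos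
  refine ⟨max K₁ 1, fun K₀ hK₀ => ?_⟩
  have hK₁ : K₁ ≤ K₀ := (le_max_left _ _).trans hK₀
  have hK₀1 : 1 ≤ K₀ := (le_max_right _ _).trans hK₀
  obtain ⟨e₁, he₁, hD1⟩ := hD K₀ hK₁
  have hδpos : (0 : ℝ) < 1 / (4 * K₀) := by
    have : (0 : ℝ) < K₀ := by exact_mod_cast hK₀1
    positivity
  set Kd : ℝ := latticeConst d (1 / (4 * K₀)) with hKd
  have hKd0 : 0 ≤ Kd := latticeConst_nonneg d hδpos.le
  refine ⟨c₀ * Real.exp (1 / (2 * K₀)) * Kd, by positivity, ?_⟩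
  intro P hPd hPL hK₀M k hk1 hk hsz hε sq₂ sq₁ h12 hΩ x μ hx φ lam hlam hlip ρ hρ
  set Ω := underRegion k sq₂ with hΩdef
  have hak : 0 ≤ B1.aSeq a P.L k := by
    have hL1 : (1 : ℝ) < P.L := by rw [hPL]; exact_mod_cast hL
    exact (B1.aSeq_pos ha hL1 hk1).le
  -- `A = 0` is (I.2.23)-regular on `Ω` with constant `0`
  have hreg : ∀ z ∈ Ω, ∀ μ ν : Fin P.d,
      P.mesh k * |C.e| / e₁ * |(0 : HiggsLattice.VecField P 0) ⟨z.shift μ, ν⟩ - (0 : HiggsLattice.VecField P 0) ⟨z, ν⟩|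
        ≤ 0 * e₁ ^ ((1 : ℝ) - 1) / (P.L : ℝ) ^ k := by
    intro z _ μ ν
    simp
  -- both ends of the bond lie in `Ω`, so `ȳ = x_k ∈ □₂`
  have hxΩ : x ∈ Ω := hx x (by rw [tdist_self]; positivity)
  have hxμΩ : x.shift μ ∈ Ω := hx (x.shift μ) ((tdist_shift_le_one x μ).trans (by omega))
  have hxsq : blockIter k x ∈ sq₂ := (mem_underRegion k sq₂ x).1 hxΩ
  -- the two families of one-block DERIVATIVE terms and the weight
  set u : HiggsLattice.Site P k → EuclideanSpace ℝ (Fin N) := fun y =>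
    covDeriv C (0 : HiggsLattice.VecField P 0)
      (propagatorK C Ω (0 : HiggsLattice.VecField P 0) msq a k
        (avgQkAdj C (0 : HiggsLattice.VecField P 0) k (Pi.single y (φ (blockIter k x)))))
      (⟨x, μ⟩ : HiggsLattice.PBond P 0) with hudef
  set u' : HiggsLattice.Site P k → EuclideanSpace ℝ (Fin N) := fun y =>
    covDeriv C (0 : HiggsLattice.VecField P 0)
      (propagatorK C Ω (0 : HiggsLattice.VecField P 0) msq a k
        (avgQkAdj C (0 : HiggsLattice.VecField P 0) k (Pi.single y (φ y))))
      (⟨x, μ⟩ : HiggsLattice.PBond P 0) with hu'def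
  set e : HiggsLattice.Site P k → ℝ := fun y =>
    Real.exp (-(1 / (4 * K₀) * (HiggsLattice.Site.tdist (blockIter k x) y : ℝ))) with hedef
  have he : ∀ y, 0 ≤ e y := fun y => Real.exp_nonneg _
  -- Prop. 2.2 (2.58), DERIVATIVE member, at `A = 0` for the one-block sources, `y′ ∈ □₂`
  have hker : ∀ y ∈ sq₂, ∀ v : EuclideanSpace ℝ (Fin N),
      ‖covDeriv C (0 : HiggsLattice.VecField P 0)
          (propagatorK C Ω (0 : HiggsLattice.VecField P 0) msq a k
            (avgQkAdj C (0 : HiggsLattice.VecField P 0) k (Pi.single y v))) (⟨x, μ⟩ : HiggsLattice.PBond P 0)‖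
        ≤ (c₀ * Real.exp (1 / (2 * K₀))) * P.mesh k *
            Real.exp (-(1 / (2 * K₀) * (HiggsLattice.Site.tdist (blockIter k x) y : ℝ))) * ‖v‖ := by
    intro y hy v
    have hyΩ : ∀ z : HiggsLattice.Site P 0, blockIter k z = y → z ∈ Ω := by
      intro z hz
      rw [hΩdef, mem_underRegion, hz]
      exact hy
    have h := hD1 P hPd hPL hK₀M hk1 hk hsz hε Ω hΩ (0 : HiggsLattice.VecField P 0) he₁ le_rfl hreg x μ hx y v
    rwa [chi_smul_avgQkAdj_single C (0 : HiggsLattice.VecField P 0) k Ω y v hyΩ] at h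
  set α : ℝ := c₀ * Real.exp (1 / (2 * K₀)) * P.mesh k * (4 * K₀ * lam) with hαdef
  set β' : ℝ := c₀ * Real.exp (1 / (2 * K₀)) * P.mesh k *
    (Real.exp (-(1 / (4 * K₀) * ρ)) * ‖φ (blockIter k x)‖) with hβdef
  have hmesh : 0 < P.mesh k := P.mesh_pos k
  have hα : 0 ≤ α := by positivity
  have hβ' : 0 ≤ β' := by positivity
  -- (i) `y′ ∈ □₁`: the Lipschitz terms
  have h1 : ∀ y ∈ sq₁, ‖u' y - u y‖ ≤ α * e y := by
    intro y hy
    have hdiff : u' y - u y = covDeriv C (0 : HiggsLattice.VecField P 0)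
        (propagatorK C Ω (0 : HiggsLattice.VecField P 0) msq a k
          (avgQkAdj C (0 : HiggsLattice.VecField P 0) k (Pi.single y (φ y - φ (blockIter k x)))))
        (⟨x, μ⟩ : HiggsLattice.PBond P 0) := by
      rw [hu'def, hudef]
      simp only
      rw [Pi.single_sub, map_sub, map_sub, covDeriv_sub']
    have hb := hker y (h12 hy) (φ y - φ (blockIter k x))
    have hm2 : 0 ≤ c₀ * Real.exp (1 / (2 * K₀)) * P.mesh k := by positivity
    have hτ : 0 ≤ (HiggsLattice.Site.tdist (blockIter k x) y : ℝ) := Nat.cast_nonneg _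
    have hle := mul_exp_le'' hK₀1 hτ
    rw [hdiff]
    calc ‖covDeriv C (0 : HiggsLattice.VecField P 0)
            (propagatorK C Ω (0 : HiggsLattice.VecField P 0) msq a k
              (avgQkAdj C (0 : HiggsLattice.VecField P 0) k (Pi.single y (φ y - φ (blockIter k x)))))
            (⟨x, μ⟩ : HiggsLattice.PBond P 0)‖
        ≤ (c₀ * Real.exp (1 / (2 * K₀))) * P.mesh k *
            Real.exp (-(1 / (2 * K₀) * (HiggsLattice.Site.tdist (blockIter k x) y : ℝ))) *
              ‖φ y - φ (blockIter k x)‖ := hb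
      _ ≤ (c₀ * Real.exp (1 / (2 * K₀))) * P.mesh k *
            Real.exp (-(1 / (2 * K₀) * (HiggsLattice.Site.tdist (blockIter k x) y : ℝ))) *
              (lam * (HiggsLattice.Site.tdist (blockIter k x) y : ℝ)) :=
          mul_le_mul_of_nonneg_left (hlip y hy) (by positivity)
      _ = (c₀ * Real.exp (1 / (2 * K₀))) * P.mesh k * lam *
            ((HiggsLattice.Site.tdist (blockIter k x) y : ℝ) *
              Real.exp (-(1 / (2 * K₀) * (HiggsLattice.Site.tdist (blockIter k x) y : ℝ)))) := by ring
      _ ≤ (c₀ * Real.exp (1 / (2 * K₀))) * P.mesh k * lam * (4 * K₀ * e y) :=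
          mul_le_mul_of_nonneg_left hle (by positivity)
      _ = α * e y := by rw [hαdef]; ring
  -- (ii) `y′ ∈ □₂ ∖ □₁`: the tail terms
  have h2 : ∀ y ∈ sq₂ \ sq₁, ‖u y‖ ≤ β' * e y := by
    intro y hy
    rw [Finset.mem_sdiff] at hy
    have hb := hker y hy.1 (φ (blockIter k x))
    have htail := exp_tail_le'' K₀ (hρ y hy.1 hy.2)
    have hm2 : 0 ≤ c₀ * Real.exp (1 / (2 * K₀)) * P.mesh k := by positivity
    calc ‖u y‖
        ≤ (c₀ * Real.exp (1 / (2 * K₀))) * P.mesh k *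
            Real.exp (-(1 / (2 * K₀) * (HiggsLattice.Site.tdist (blockIter k x) y : ℝ))) * ‖φ (blockIter k x)‖ := hb
      _ ≤ (c₀ * Real.exp (1 / (2 * K₀))) * P.mesh k *
            (Real.exp (-(1 / (4 * K₀) * ρ)) * e y) * ‖φ (blockIter k x)‖ :=
          mul_le_mul_of_nonneg_right (mul_le_mul_of_nonneg_left htail hm2) (norm_nonneg _)
      _ = β' * e y := by rw [hβdef]; ring
  -- (iii) the lattice sum
  have hsum : ∑ y ∈ sq₂, e y ≤ Kd := by
    have h := sum_exp_neg_tdist_le (P := P) (k := k) hδpos (blockIter k x)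
    rw [hPd] at h
    exact (Finset.sum_le_sum_of_subset_of_nonneg (Finset.subset_univ sq₂) fun y _ _ => he y).trans h
  -- (iv) the derivative as a sum, the vanishing constant term, and the assembly
  have hmain := norm_sum_sub_sum_le'' sq₁ sq₂ h12 u u' e he hα hβ' h1 h2 hsum
  have hφ' : covDeriv C (0 : HiggsLattice.VecField P 0)
        (bgScalar256 C msq a k sq₂ sq₁ (0 : HiggsLattice.VecField P 0) φ) (⟨x, μ⟩ : HiggsLattice.PBond P 0)
      = (B1.aSeq a P.L k * (P.mesh k ^ 2)⁻¹) • ∑ y ∈ sq₁, u' y := by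
    rw [covDeriv_bgScalar256_eq_sum]
  have hconst : (B1.aSeq a P.L k * (P.mesh k ^ 2)⁻¹) • ∑ y ∈ sq₂, u y = 0 := by
    have h := covDeriv_bgScalar256_eq_sum C msq a k sq₂ sq₂ (0 : HiggsLattice.VecField P 0)
      (fun _ => φ (blockIter k x)) (⟨x, μ⟩ : HiggsLattice.PBond P 0)
    rw [covDeriv_bgScalar256_const_eq_zero C hk hmsq hak sq₂ (φ (blockIter k x)) hxΩ hxμΩ] at h
    exact h.symm
  have hcoef : 0 ≤ B1.aSeq a P.L k * (P.mesh k ^ 2)⁻¹ := mul_nonneg hak (inv_nonneg.2 (sq_nonneg _))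
  rw [hφ', ← sub_zero ((B1.aSeq a P.L k * (P.mesh k ^ 2)⁻¹) • ∑ y ∈ sq₁, u' y), ← hconst, ← smul_sub, norm_smul,
    Real.norm_eq_abs, abs_of_nonneg hcoef, norm_sub_rev]
  calc B1.aSeq a P.L k * (P.mesh k ^ 2)⁻¹ * ‖∑ y ∈ sq₂, u y - ∑ y ∈ sq₁, u' y‖
      ≤ B1.aSeq a P.L k * (P.mesh k ^ 2)⁻¹ * ((α + β') * Kd) := mul_le_mul_of_nonneg_left hmain hcoef
    _ = B1.aSeq a P.L k * (c₀ * Real.exp (1 / (2 * K₀)) * Kd) * (P.mesh k)⁻¹ *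
          (4 * K₀ * lam + Real.exp (-(1 / (4 * K₀) * ρ)) * ‖φ (blockIter k x)‖) := by
        rw [hαdef, hβdef]
        field_simp

end Eq276Deriv

end Literature.MathematicalPhysics.QuantumFieldTheory.Balaban1983to89.B2Eq276DerivHiggsRegion

end
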